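import Summits.BirchSwinnertonDyer.BirchSwinnertonDyer.Theorems.UniversalToricDescentHessianTwinSemistableAtThree
import HarnessLib

/-!
# Route `UniversalToricDescent`, crux #3 buckets A/B (items 20693 / 20694): the Hessian is the semistable twin — VALUATION CURRENCY (types `(≥5,6,9)`, `(4,6,≥10)` ↦ multiplicative twin; `(4,6,9)` ↦ good ordinary twin; `v₃(c₄) ≥ 4, v₃(c₆) = 6` ↦ on the twin cell), PROVED

Cell `bsd-wall` (W-ALL lane 3, row 2·3@3), seat `bsd-wall-utd-p2` g7 (LEAD, line mode; second item 20694),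
2026-08-27. `--supports stmt-BirchSwinnertonDyer-20694`. Corollaries, in the census's valuation currency
(`padicValRat 3` of `c₄`, `c₆`, `Δ` of a globally minimal model), of
`UniversalToricDescentHessianTwinSemistableAtThree.lean` (integer form: `c₄ = 3⁴u`, `c₆ = 3⁶w`, `3 ∤ w`;
Hessian multiplicative iff `3 ∣ u⁶(w² − u³)`, good ordinary otherwise), via `v₃(Δ) = 9 + v₃(u³ − w²)`
(`padicValRat_Δ_eq`).

WHAT IS PROVED (no `sorry`, no named fact): `exists_mult_twin_of_padicValRat_of_five_le`
(`5 ≤ v₃(c₄)`, `v₃(c₆) = 6` ⟹ a globally minimal `3`-congruent twin MULTIPLICATIVE at `3`),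
`exists_mult_twin_of_padicValRat_of_ten_le` (`v₃(c₄) = 4`, `v₃(c₆) = 6`, `10 ≤ v₃(Δ)` ⟹ same),
`exists_goodOrd_twin_of_padicValRat` (`v₃(c₄) = 4`, `v₃(c₆) = 6`, `v₃(Δ) = 9` ⟹ a globally minimal
`3`-congruent twin GOOD ORDINARY at `3`), `exists_semistable_surj_twin_of_padicValRat` (`4 ≤ v₃(c₄)`,
`v₃(c₆) = 6`, onto mod-`3` image ⟹ ON THE TWIN CELL of the W-ALL leaf `WAllExclAddWildRankOneSurjTwin` with a
NAMED twin; the twinless leaf is vacuous on these types). In every case the twin is a global minimal model of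
the Hessian member `D(0:1) = Fisher2012.hessePencil3 c₄ c₆ 0 1`. utd-idea g9's HESSIAN LAW rows `(4,6,9)`
(`334/334`), `(4,6,10)`, `(4,6,11)`, `(k,6,9)`, `k ≥ 5` become theorems for every curve of those types; rows
`(k,4,5)`, `(6,8,13)` of bucket B are NOT treated (another integer model is needed).

HONEST FRAMING: helper theorems; bucket B's crux (item 20694) is neither proved nor reduced; nothing closes; no
statement item filed (D-0014); BSD is not proved for any curve. References: T. Fisher, Proc. LMS (3) 104 (2012)
§8, Thm. 13.2 [Fisher2012Hessian]; J. H. Silverman, *AEC* III §1, VII.5 Prop. 5.1 [SilvermanAEC2009].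
-/

set_option autoImplicit false
set_option linter.dupNamespace false

noncomputable section

namespace Summit.BirchSwinnertonDyer.BirchSwinnertonDyer.Theorems.UniversalToricDescentHessianTwin

open WeierstrassCurve
  Literature.NumberTheory.EllipticCurves
  Literature.NumberTheory.EllipticCurves.Rank1Residual
  Literature.NumberTheory.EllipticCurves.Fisher2012
  Summit.BirchSwinnertonDyer.Rank1Residual
  Summit.BirchSwinnertonDyer.BirchSwinnertonDyer.Theorems.UniversalToricDescentTwinChoice

/-- `v₃(n) = 6` for an integer `n` (read in `ℚ`) means `n = 3⁶w` with `3 ∤ w`. [folklore] -/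
theorem exists_eq_pow_six_mul_of_padicValRat_eq_six (n : ℤ) (h : padicValRat 3 (n : ℚ) = 6) :
    ∃ w : ℤ, ¬ (3 : ℤ) ∣ w ∧ n = 3 ^ 6 * w := by
  rw [padicValRat.of_int] at h
  have h' : padicValInt 3 n = 6 := by exact_mod_cast h
  have hn : n ≠ 0 := by rintro rfl; simp at h'
  obtain ⟨w, hw⟩ : (3 : ℤ) ^ 6 ∣ n := (padicValInt_dvd_iff 6 n).mpr (Or.inr h'.ge)
  refine ⟨w, fun h3 ↦ ?_, hw⟩
  have h7 : (3 : ℤ) ^ 7 ∣ n := by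
    rw [hw, pow_succ]
    exact mul_dvd_mul_left _ h3
  rcases (padicValInt_dvd_iff 7 n).mp (by exact_mod_cast h7) with h0 | h7'
  · exact hn h0
  · omega

/-- `v₃(n) ≥ 4` for an integer `n` (read in `ℚ`) gives `n = 3⁴u` with `u ≠ 0`. [folklore] -/
theorem exists_eq_pow_four_mul_of_four_le_padicValRat (n : ℤ) (h : 4 ≤ padicValRat 3 (n : ℚ)) :
    ∃ u : ℤ, u ≠ 0 ∧ n = 3 ^ 4 * u := by
  rw [padicValRat.of_int] at h
  have h' : 4 ≤ padicValInt 3 n := by exact_mod_cast h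
  have hn : n ≠ 0 := by rintro rfl; simp at h'
  obtain ⟨u, hu⟩ : (3 : ℤ) ^ 4 ∣ n := (padicValInt_dvd_iff 4 n).mpr (Or.inr h')
  refine ⟨u, ?_, hu⟩
  rintro rfl
  exact hn (by rw [hu, mul_zero])

/-- `v₃(n) ≥ 5` for an integer `n` (read in `ℚ`) gives `n = 3⁴u` with `3 ∣ u`, `u ≠ 0`. [folklore] -/
theorem exists_eq_pow_four_mul_of_five_le_padicValRat (n : ℤ) (h : 5 ≤ padicValRat 3 (n : ℚ)) :
    ∃ u : ℤ, u ≠ 0 ∧ (3 : ℤ) ∣ u ∧ n = 3 ^ 4 * u := by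
  rw [padicValRat.of_int] at h
  have h' : 5 ≤ padicValInt 3 n := by exact_mod_cast h
  have hn : n ≠ 0 := by rintro rfl; simp at h'
  obtain ⟨u', hu'⟩ : (3 : ℤ) ^ 5 ∣ n := (padicValInt_dvd_iff 5 n).mpr (Or.inr h')
  refine ⟨3 * u', ?_, dvd_mul_right 3 u', by rw [hu']; ring⟩
  intro h0
  exact hn (by rw [hu']; linear_combination (3 : ℤ) ^ 4 * h0)

/-- **`v₃(Δ) = 9 + v₃(u³ − w²)`** for `c₄ = 3⁴u`, `c₆ = 3⁶w` (`1728Δ = c₄³ − c₆² = 3¹²(u³ − w²)`).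
[cite: SilvermanAEC2009, III §1] -/
theorem padicValRat_Δ_eq (W : WeierstrassCurve ℚ) [W.IsElliptic] (u w : ℤ) (h4 : W.c₄ = 3 ^ 4 * u)
    (h6 : W.c₆ = 3 ^ 6 * w) : padicValRat 3 W.Δ = 9 + padicValInt 3 (u ^ 3 - w ^ 2) := by
  have hrel := W.c_relation
  rw [h4, h6] at hrel
  have hΔ : W.Δ = 3 ^ 9 * ((u ^ 3 - w ^ 2 : ℤ) : ℚ) / 64 := by
    push_cast
    linear_combination hrel / 1728
  have hΔ0 : W.Δ ≠ 0 := W.isUnit_Δ.ne_zero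
  have hd0 : ((u ^ 3 - w ^ 2 : ℤ) : ℚ) ≠ 0 := by
    intro h0
    apply hΔ0
    rw [hΔ, h0]; ring
  have h64 : padicValRat 3 (64 : ℚ) = 0 := by
    have : (64 : ℚ) = ((64 : ℕ) : ℚ) := by norm_num
    rw [this, padicValRat.of_nat]
    norm_num [padicValNat.eq_zero_of_not_dvd]
  have h3 : padicValRat 3 (3 : ℚ) = 1 := by exact_mod_cast padicValRat.self (p := 3) (by norm_num)
  rw [hΔ, padicValRat.div (mul_ne_zero (by norm_num) hd0) (by norm_num),
    padicValRat.mul (by norm_num) hd0, padicValRat.pow, h3, padicValRat.of_int, h64]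
  push_cast
  ring

/-- **MULTIPLICATIVE TWIN on the types `(≥5, 6, ·)`**: every elliptic `W/ℚ` with integral `c₄, c₆` and
`5 ≤ v₃(c₄)`, `v₃(c₆) = 6` has a globally minimal `3`-congruent twin multiplicative at `3` (its Hessian).
Stated for a globally minimal `W` (then the type is `(k, 6, 9)`, `k ≥ 5`). [folklore] -/
theorem exists_mult_twin_of_padicValRat_of_five_le (W : WeierstrassCurve ℚ) [W.IsElliptic]
    [W.IsGloballyMinimal] (h5 : 5 ≤ padicValRat 3 W.c₄) (h6 : padicValRat 3 W.c₆ = 6) :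
    ∃ (W' : WeierstrassCurve ℚ) (_ : W'.IsElliptic) (_ : W'.IsGloballyMinimal),
      O6.ModPCongruent W' W 3 ∧ Mult W' 3 := by
  rw [c₄_eq_intCast_c₄_integralModelInt W] at h5
  rw [c₆_eq_intCast_c₆_integralModelInt W] at h6
  obtain ⟨u, hu0, hu3, hu'⟩ := exists_eq_pow_four_mul_of_five_le_padicValRat _ h5
  obtain ⟨w, hw, hw'⟩ := exists_eq_pow_six_mul_of_padicValRat_eq_six _ h6
  refine exists_mult_twin_of_c₄_c₆ W u w hu0 hw ?_ ?_ ?_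
  · exact dvd_mul_of_dvd_left (dvd_pow hu3 (by norm_num)) _
  · rw [c₄_eq_intCast_c₄_integralModelInt W, hu']; push_cast; ring
  · rw [c₆_eq_intCast_c₆_integralModelInt W, hw']; push_cast; ring

/-- **MULTIPLICATIVE TWIN on the types `(4, 6, ≥10)`**: every globally minimal elliptic `W/ℚ` with
`v₃(c₄) = 4`, `v₃(c₆) = 6`, `10 ≤ v₃(Δ)` has a globally minimal `3`-congruent twin multiplicative at `3`
(its Hessian). [folklore] -/
theorem exists_mult_twin_of_padicValRat_of_ten_le (W : WeierstrassCurve ℚ) [W.IsElliptic]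
    [W.IsGloballyMinimal] (h4 : padicValRat 3 W.c₄ = 4) (h6 : padicValRat 3 W.c₆ = 6)
    (h10 : 10 ≤ padicValRat 3 W.Δ) :
    ∃ (W' : WeierstrassCurve ℚ) (_ : W'.IsElliptic) (_ : W'.IsGloballyMinimal),
      O6.ModPCongruent W' W 3 ∧ Mult W' 3 := by
  rw [c₄_eq_intCast_c₄_integralModelInt W] at h4
  rw [c₆_eq_intCast_c₆_integralModelInt W] at h6
  obtain ⟨u, hu, hu'⟩ := exists_eq_pow_four_mul_of_padicValRat_eq_four _ h4
  obtain ⟨w, hw, hw'⟩ := exists_eq_pow_six_mul_of_padicValRat_eq_six _ h6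
  have hu0 : u ≠ 0 := by rintro rfl; exact hu (dvd_zero 3)
  have hc4 : W.c₄ = 3 ^ 4 * u := by rw [c₄_eq_intCast_c₄_integralModelInt W, hu']; push_cast; ring
  have hc6 : W.c₆ = 3 ^ 6 * w := by rw [c₆_eq_intCast_c₆_integralModelInt W, hw']; push_cast; ring
  have hval := padicValRat_Δ_eq W u w hc4 hc6
  have hd : (3 : ℤ) ∣ u ^ 3 - w ^ 2 := by
    have h1 : 1 ≤ padicValInt 3 (u ^ 3 - w ^ 2) := by
      have : (1 : ℤ) ≤ (padicValInt 3 (u ^ 3 - w ^ 2) : ℤ) := by linarith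
      exact_mod_cast this
    have := (padicValInt_dvd_iff 1 (u ^ 3 - w ^ 2)).mpr (Or.inr h1)
    simpa using this
  refine exists_mult_twin_of_c₄_c₆ W u w hu0 hw ?_ hc4 hc6
  have : (3 : ℤ) ∣ w ^ 2 - u ^ 3 := by
    have := hd.neg_right; simpa [neg_sub] using this
  exact dvd_mul_of_dvd_right this _

/-- **GOOD ORDINARY TWIN on the type `(4, 6, 9)`**: every globally minimal elliptic `W/ℚ` with
`v₃(c₄) = 4`, `v₃(c₆) = 6`, `v₃(Δ) = 9` has a globally minimal `3`-congruent twin with good ordinary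
reduction at `3` (its Hessian). [folklore] -/
theorem exists_goodOrd_twin_of_padicValRat (W : WeierstrassCurve ℚ) [W.IsElliptic]
    [W.IsGloballyMinimal] (h4 : padicValRat 3 W.c₄ = 4) (h6 : padicValRat 3 W.c₆ = 6)
    (h9 : padicValRat 3 W.Δ = 9) :
    ∃ (W' : WeierstrassCurve ℚ) (_ : W'.IsElliptic) (_ : W'.IsGloballyMinimal),
      O6.ModPCongruent W' W 3 ∧ GoodOrd W' 3 := by
  rw [c₄_eq_intCast_c₄_integralModelInt W] at h4
  rw [c₆_eq_intCast_c₆_integralModelInt W] at h6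
  obtain ⟨u, hu, hu'⟩ := exists_eq_pow_four_mul_of_padicValRat_eq_four _ h4
  obtain ⟨w, hw, hw'⟩ := exists_eq_pow_six_mul_of_padicValRat_eq_six _ h6
  have hc4 : W.c₄ = 3 ^ 4 * u := by rw [c₄_eq_intCast_c₄_integralModelInt W, hu']; push_cast; ring
  have hc6 : W.c₆ = 3 ^ 6 * w := by rw [c₆_eq_intCast_c₆_integralModelInt W, hw']; push_cast; ring
  have hval := padicValRat_Δ_eq W u w hc4 hc6
  have hd : ¬ (3 : ℤ) ∣ w ^ 2 - u ^ 3 := by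
    intro h3
    have h3' : (3 : ℤ) ^ 1 ∣ u ^ 3 - w ^ 2 := by
      have := h3.neg_right; simpa [neg_sub] using this
    rcases (padicValInt_dvd_iff 1 (u ^ 3 - w ^ 2)).mp h3' with h0 | h1
    · have : W.Δ = 0 := by
        have hrel := W.c_relation
        rw [hc4, hc6] at hrel
        have h0' : ((u ^ 3 - w ^ 2 : ℤ) : ℚ) = 0 := by exact_mod_cast h0
        push_cast at h0'
        linear_combination hrel / 1728 + (3 : ℚ) ^ 12 / 1728 * h0'
      exact W.isUnit_Δ.ne_zero this
    · have : (1 : ℤ) ≤ (padicValInt 3 (u ^ 3 - w ^ 2) : ℤ) := by exact_mod_cast h1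
      linarith
  exact exists_goodOrd_twin_of_c₄_c₆ W u w hu hw hd hc4 hc6

/-- **Every globally minimal `W` with `v₃(c₄) ≥ 4`, `v₃(c₆) = 6` and onto mod-`3` image is ON THE TWIN CELL**
of the W-ALL leaf `WAllExclAddWildRankOneSurjTwin`, with a NAMED twin (a global minimal model of its
Hessian): `3`-congruent, NOT additive at `3` (multiplicative or good ordinary), onto. [folklore] -/
theorem exists_semistable_surj_twin_of_padicValRat (W : WeierstrassCurve ℚ) [W.IsElliptic]
    [W.IsGloballyMinimal] (h4 : 4 ≤ padicValRat 3 W.c₄) (h6 : padicValRat 3 W.c₆ = 6)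
    (hs : W.HasSurjectiveModNGaloisRep 3) :
    ∃ (W' : WeierstrassCurve ℚ) (_ : W'.IsElliptic) (_ : W'.IsGloballyMinimal),
      O6.ModPCongruent W' W 3 ∧ ¬ Addv W' 3 ∧ W'.HasSurjectiveModNGaloisRep 3 := by
  have h4' := h4
  rw [c₄_eq_intCast_c₄_integralModelInt W] at h4'
  have h6' := h6
  rw [c₆_eq_intCast_c₆_integralModelInt W] at h6'
  obtain ⟨u, hu0, hu'⟩ := exists_eq_pow_four_mul_of_four_le_padicValRat _ h4'
  obtain ⟨w, hw, hw'⟩ := exists_eq_pow_six_mul_of_padicValRat_eq_six _ h6'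
  have hc4 : W.c₄ = 3 ^ 4 * u := by rw [c₄_eq_intCast_c₄_integralModelInt W, hu']; push_cast; ring
  have hc6 : W.c₆ = 3 ^ 6 * w := by rw [c₆_eq_intCast_c₆_integralModelInt W, hw']; push_cast; ring
  by_cases hΔ : (3 : ℤ) ∣ u ^ 6 * (w ^ 2 - u ^ 3)
  · obtain ⟨W', i1, i2, hc, hm⟩ := exists_mult_twin_of_c₄_c₆ W u w hu0 hw hΔ hc4 hc6
    exact ⟨W', i1, i2, hc, fun h ↦ h.2 hm, hasSurjectiveModNGaloisRep_of_modPCongruent' hc hs⟩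
  · have h3 : Prime (3 : ℤ) := Int.prime_three
    have hu : ¬ (3 : ℤ) ∣ u := fun h ↦ hΔ (dvd_mul_of_dvd_left (dvd_pow h (by norm_num)) _)
    have hd : ¬ (3 : ℤ) ∣ w ^ 2 - u ^ 3 := fun h ↦ hΔ (dvd_mul_of_dvd_right h _)
    obtain ⟨W', i1, i2, hc, hg⟩ := exists_goodOrd_twin_of_c₄_c₆ W u w hu hw hd hc4 hc6
    exact ⟨W', i1, i2, hc, fun h ↦ h.1 hg.1, hasSurjectiveModNGaloisRep_of_modPCongruent' hc hs⟩

end Summit.BirchSwinnertonDyer.BirchSwinnertonDyer.Theorems.UniversalToricDescentHessianTwin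

end
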